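import Literature.NumberTheory.EllipticCurves.EisensteinNewformLevelRaisingInertiaLFactorProofs
import Literature.NumberTheory.EllipticCurves.EisensteinNewformLevelRaisingInertiaLocalComponentProofs
import Literature.NumberTheory.EllipticCurves.EisensteinNewformLevelRaisingProofs
import Literature.NumberTheory.GaloisRepresentations.TateTwistFrobeniusProofs
import Literature.NumberTheory.GaloisRepresentations.FramedRepTwistEulerFactorProofs
import HarnessLib

/-!
# Hida (2000), Thm. 3.26 (3)(a), inertia at `ℓ ∣ N` — Part D: the named fact from the Carayol
# carrier `galoisRep_GL2_totallyReal_localGlobal` alone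

Topic `Literature/NumberTheory/EllipticCurves`; sibling proof file of `EisensteinNewformLevelRaising`
(the named fact `Literature.NumberTheory.EllipticCurves.Hida2000_thm326_inertia_of_level`) and of
Parts A–I, L, B, C.  THEOREMS ONLY (no definition, no named fact; D-0026).

Main result: `Hida2000Thm326.inertia_of_level_of_localGlobal'
(hX : Automorphic.galoisRep_GL2_totallyReal_localGlobal) : Hida2000_thm326_inertia_of_level` — the
hypotheses `hrec` (Part H), `hL`/`hZ` (Part I) are gone.  For a newform `g ∈ S_k(Γ₁(N))`, `k ≥ 2`,
nebentypus `χ`, `ρ : Γ_ℚ → GL₂(ℚ̄_p)` irreducible and attached to `g` away from `Np`, and `ℓ ∣ N`,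
`ℓ ≠ p`, `v_ℓ(N) = v_ℓ(cond χ)`:

* **D-a** (`exists_detTwist_datum`): the cuspidal datum `π = π_g ⊗ |det|_𝔸^{(k-1)/2}` (Gelbart 1975,
  §5; no finite-order twist) has the weight-`k` infinity type, Satake parameters at `ℓ' ∤ N` with
  inverse-root polynomial `X² - a_{ℓ'} χ(ℓ')⁻¹ X + χ(ℓ')⁻¹ ℓ'^{k-1}`, and the class of
  `φ_g · |det|^{(k-1)/2}` is a non-zero `{1} × K₁(N)`-fixed vector of `W / W'` on which
  `U_w = ∑_{j<ℓ} r(ι_w(ℓ j; 0 1))` acts by `ℓ^{-(k-1)/2} a_ℓ / (√ℓ)^{k-2}` (Part B's `U_ℓ` identity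
  `sum_adelicLiftFun_mul_eq_of_isNewform1_of_dvd`).
* **D-b** (`exists_continuousMonoidHom_dirichlet`): `θ₀ = ι⁻¹ ∘ χ ∘ χ_N : Γ_ℚ →ₜ* ℚ̄_pˣ`; the twist
  `r = ρ ⊗ θ₀⁻¹` is irreducible, unramified away from `Np`, and its Frobenius polynomials are the
  `arithFrobPolyOfSatake` of the Satake parameters of `π` (`SatakeFrobCompatibleAE ι π r`).
* **D-c** (`inertiaInvariants_ne_bot_of_rsZeta_not_laurent`): the local core of Part I — a zeta
  integral `Z(s, W, 1)` with a pole forces `W^{I} ≠ 0` for every Frobenius-semisimple `W ∈ rec(π_w)`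
  (clauses (iii-L), (ii) of `LocalLanglandsDatum.isLocalLanglands`).
* **D-d** (`inertia_of_level_of_localGlobal'`): the carrier at `(ℚ, π, p, ι, r)` gives `π_w`, `r_w`,
  `ι(r_w)` and `ι(r_w)^{F-ss} ∈ rec(π_w)` at `w ∣ ℓ`; `a_ℓ ≠ 0` (`coeff_ne_zero_of_padicValNat_eq`,
  Li 1975) makes Part C's `exists_rsZeta_not_laurent_of_newvector` applicable, so `tr = 1 + det` on
  inertia for `rec(π_w)`, `ι(r_w)`, `r_w`, `r|_{Γ_{ℚ_w}}` (Part H's transport); untwisting with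
  `det ρ = ι⁻¹χ(χ_N) χ_p^{k-1}` (`det_eq_of_isGaloisRepOfNewform1`, `χ_p = 1` on `I_ℓ`) gives
  `tr ρ = 1 + ι⁻¹χ(χ_N)` on the inertia at `w`, and Part E's socket
  `inertia_shape_of_local_inertial_trace` yields `ρ|_{I_𝔔} ~ (χ ⊕ 1)`.

What remains for `Hida2000_thm326_inertia_of_level_holds` is exactly a proof `X_holds` of the
carrier `Automorphic.galoisRep_GL2_totallyReal_localGlobal` (Carayol 1986, Thm. (A), packaged with
Fontaine's `D_pst` at `p`): `Hida2000_thm326_inertia_of_level_holds := inertia_of_level_of_localGlobal' X_holds`.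

References: Hida, *Modular Forms and Galois Cohomology* (2000), Thm. 3.26, pp. 152–153; Carayol,
Ann. Sci. ÉNS 19 (1986), Thm. (A); Gelbart, *Automorphic forms on adele groups* (1975), §5,
Thm. 5.19; Deligne–Serre, Ann. Sci. ÉNS 7 (1974), 4.4; Serre, *Abelian ℓ-adic representations*
(1968), Ch. I §2; W. Li, Math. Ann. 212 (1975), Thm. 3; Diamond–Shurman (2005), Prop. 5.2.1;
Jacquet–Piatetski-Shapiro–Shalika (1983), Thm. 2.7; Harris–Taylor (2001), Thm. A; Tate, Corvallis
1979, (4.1.6).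
-/

noncomputable section

open scoped MatrixGroups Matrix NumberField ModularForm Classical
open Matrix CongruenceSubgroup IsDedekindDomain Field NumberField Polynomial Filter MeasureTheory

namespace Literature.NumberTheory.EllipticCurves.Hida2000Thm326

open Literature.NumberTheory.EllipticCurves.ModularForms
open Literature.NumberTheory.GaloisRepresentations Literature.NumberTheory.Automorphic
open Rat.HeightOneSpectrum UpperHalfPlane

/-! ### D-b. The twisting character `η = (ι⁻¹ ∘ χ ∘ χ_N)⁻¹ : Γ_ℚ →ₜ* ℚ̄_pˣ` -/

section Character

variable {N : ℕ} [NeZero N]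

/-- **A Dirichlet character read on `Γ_ℚ` with values in `ℚ̄_pˣ`** (Deligne–Serre 1974, 4.4:
`σ ↦ ε(χ_N(σ))`, here pushed along a field isomorphism `ι⁻¹ : ℂ ≃ ℚ̄_p`): a continuous (locally
constant) homomorphism `Γ_ℚ →ₜ* ℚ̄_pˣ`, as `dirichletGaloisCharacter` of `ModNCyclotomicCharacter`.
[folklore] -/
theorem exists_continuousMonoidHom_dirichlet {p : ℕ} [Fact p.Prime] (ι : PadicAlgCl p ≃+* ℂ)
    (ε : DirichletCharacter ℂ N) :
    ∃ θ : absoluteGaloisGroup ℚ →ₜ* (PadicAlgCl p)ˣ,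
      ∀ σ, ((θ σ : (PadicAlgCl p)ˣ) : PadicAlgCl p) = ι.symm (ε (modNCyclotomicCharacter ℚ N σ : ZMod N)) := by
  haveI : NeZero (N : ℚ) := NeZero.charZero
  set χ : absoluteGaloisGroup ℚ →* (PadicAlgCl p)ˣ :=
    (Units.map ((ι.symm : ℂ ≃+* PadicAlgCl p) : ℂ →* PadicAlgCl p)).comp
      (ε.toUnitHom.comp (modNCyclotomicCharacter ℚ N)) with hχ
  have hcont : Continuous χ := by
    refine continuous_of_continuousAt_one χ ?_
    rw [ContinuousAt, map_one]
    refine Filter.Tendsto.mono_right ?_ (pure_le_nhds 1)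
    rw [Filter.tendsto_pure]
    filter_upwards [modNCyclotomicCharacter_eventually_eq_one ℚ N] with σ hσ
    simp only [hχ, MonoidHom.coe_comp, Function.comp_apply, hσ, map_one]
  exact ⟨⟨χ, hcont⟩, fun σ => rfl⟩

end Character

/-! ### D-c. The local core: a zeta integral with a pole forces an inertia-fixed vector -/

section LocalCore

open scoped Valued
open ValuativeRel

/-- **A pole of `Z(s, W, 1)` forces `rec(π_w)^{I} ≠ 0`** — the local core of
`inertia_of_level_of_localGlobal_of_rsZeta_not_laurent`: for a local Langlands datum `d` of a
non-archimedean local field `F`, an irreducible smooth `π_v` of `GL₂(F)` generic for a non-trivial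
continuous `ψ`, an invariant Radon measure `ν` on `GL₁(F) ⧸ U₁`, Whittaker functionals `Λ`
(of `π_v`) and `Λ'` (of the trivial representation of `GL₁(F)` on `ℂ`, for `ψ⁻¹`) and vectors
`v, v'` whose `GL₂ × GL₁` zeta integral is not a Laurent polynomial in `q^{-s}` on any right
half-plane, every Frobenius-semisimple `W` of class `d.recGL 2 ⟦π_v⟧` has `W^{I_F} ≠ 0`: by
clauses (iii-L) and (ii) of `d.isLocalLanglands` the Euler factor of `rec π_v ⊗ rec 1` is a JPSS
`L`-polynomial of the pair, hence `≠ 1`, and `inertiaInvariants_ne_bot_of_eulerFactor_tprod_ne_one`.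
[cite: JacquetPiatetskiShapiroShalika1983, Thm. 2.7 (i), (2.4)] [cite: HarrisTaylorAMS2001, Thm. A (ii), (v)] -/
theorem inertiaInvariants_ne_bot_of_rsZeta_not_laurent {F : Type} [Field F] [ValuativeRel F]
    [TopologicalSpace F] [IsNonarchimedeanLocalField F] (d : LocalLanglandsDatum F)
    (πv : SmoothIrrep (GL (Fin 2) F)) [MeasurableSpace (GL (Fin 1) F ⧸ upperUnitriangular (Fin 1) F)]
    [BorelSpace (GL (Fin 1) F ⧸ upperUnitriangular (Fin 1) F)]
    {ψ : AddChar F Circle} {ν : Measure (GL (Fin 1) F ⧸ upperUnitriangular (Fin 1) F)}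
    (hψ : ψ.IsContinuousNontrivial) (hgen : IsGeneric πv.ρ ψ)
    [SMulInvariantMeasure (GL (Fin 1) F) (GL (Fin 1) F ⧸ upperUnitriangular (Fin 1) F) ν]
    [IsFiniteMeasureOnCompacts ν] [ν.IsOpenPosMeasure]
    {Λ : Module.Dual ℂ πv.V} (hΛ : Λ ∈ whittakerFunctionals πv.ρ ψ)
    {Λ' : Module.Dual ℂ ℂ} (hΛ' : Λ' ∈ whittakerFunctionals (Representation.trivial ℂ (GL (Fin 1) F) ℂ) ψ⁻¹)
    (v : πv.V) (v' : ℂ)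
    (hno : ∀ R : RatFunc ℂ, IsLaurent R →
      ¬ EqOnRightHalfPlane (IsNonarchimedeanLocalField.residueFieldCard F)
        (rsZeta Nat.one_lt_two ν (whittakerModel πv.ρ Λ v)
          (whittakerModel (Representation.trivial ℂ (GL (Fin 1) F) ℂ) Λ' v')) R)
    (W : WeilDeligneRep F ℂ (Fin 2 → ℂ)) (hW : W.IsFrobSemisimple)
    (hq : Quotient.mk (frobSemisimpleWDSetoid F 2) ⟨W, hW⟩ = d.recGL 2 (IrrClass.mk πv)) :
    W.inertiaInvariants ≠ ⊥ := by
  -- the trivial irreducible smooth representation `1 ∘ det` of `GL₁(F)` on `ℂ`, generic for `ψ⁻¹`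
  let π' : SmoothIrrep (GL (Fin 1) F) :=
    { V := ℂ
      ρ := Representation.trivial ℂ (GL (Fin 1) F) ℂ
      isIrreducible := isIrreducible_of_finrank_eq_one' _ (Module.finrank_self ℂ)
      isSmooth := fun v => by
        have h : ((Representation.trivial ℂ (GL (Fin 1) F) ℂ).stabilizerSubgroup v : Set (GL (Fin 1) F)) = Set.univ := by
          ext x
          simp [Representation.mem_stabilizerSubgroup]
        rw [Representation.IsSmoothVector, h]
        exact isOpen_univ }
  have hgen' : IsGeneric π'.ρ ψ⁻¹ := by
    refine (isGeneric_iff _ _).2 ⟨LinearMap.id, (mem_whittakerFunctionals_iff _).2 fun u v => ?_,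
      fun h => one_ne_zero (LinearMap.congr_fun h (1 : ℂ))⟩
    have hs : superdiagSum u = 0 := by
      rw [superdiagSum_def]
      refine Finset.sum_eq_zero fun i _ => ?_
      have hi := i.isLt
      simp
    rw [whittakerCharFun_apply, hs, AddChar.map_zero_eq_one, Circle.coe_one, one_mul]
    rfl
  set P₀ : ℂ[X] := (((d.recGL 2 (IrrClass.mk πv)).out.1).tprod
      ((d.recGL 1 (IrrClass.mk π')).out.1)).eulerFactor d.hn d.hex with hP₀
  have hRS₀ : HasRSLFactor Nat.one_lt_two πv.ρ π'.ρ ψ ν P₀ :=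
    (d.isLocalLanglands.lFactor_pairs Nat.one_pos Nat.one_lt_two πv π' ψ hψ hgen hgen' ν P₀).mpr hP₀
  have hE : P₀ ≠ 1 := by
    intro h1
    obtain ⟨-, ha, -⟩ := hRS₀
    obtain ⟨R, hR, hEq⟩ := ha Λ hΛ Λ' hΛ' v v'
    rw [h1, rsLRat, map_one, inv_one, mul_one] at hEq
    exact hno R hR hEq
  exact inertiaInvariants_ne_bot_of_eulerFactor_tprod_ne_one d πv π' (fun _ _ => rfl) (hP₀ ▸ hE) W hW hq

end LocalCore

/-! ### D-a. The cuspidal datum `π_g ⊗ |det|^{(k-1)/2}` and its new vector -/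

section Datum

variable {N : ℕ} [NeZero N] {k : ℤ}

/-- `p^{-(k-1)/2} = (√p)^{-m}` for `k - 1 = m`. [folklore] -/
theorem natCast_cpow_neg_half_weight' {p : ℕ} {k : ℤ} {m : ℕ} (hm : k - 1 = m) :
    (p : ℂ) ^ (-((((k : ℝ) - 1) / 2 : ℝ) : ℂ)) = (((Real.sqrt p : ℝ) : ℂ) ^ m)⁻¹ := by
  have hp : (0 : ℝ) ≤ p := Nat.cast_nonneg p
  have hkm : (k : ℝ) - 1 = (m : ℝ) := by exact_mod_cast hm
  rw [hkm, ← Complex.ofReal_neg, ← Complex.ofReal_natCast, ← Complex.ofReal_cpow hp,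
    ← Complex.ofReal_pow, ← Complex.ofReal_inv, Real.rpow_neg hp, Real.sqrt_eq_rpow,
    ← Real.rpow_natCast, ← Real.rpow_mul hp]
  congr 3
  ring

/-- **The Satake polynomial of `π_g ⊗ |det|^{(k-1)/2}`.** If `α₁ + α₂ = a S^{-m}`, `α₁ α₂ = e ≠ 0`
(the unitary Satake parameter of `π_g` at `p`, `S = √p`, `m = k - 1`), then
`∏ᵢ (X - (S^{-m} αᵢ)⁻¹) = X² - (a/e) X + S^{2m}/e` — the inverse-root polynomial
`X² - \bar{a_p} X + \bar{χ}(p) p^{k-1}` of the twist. [folklore] -/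
theorem prod_X_sub_C_inv_pair_detTwist {α₁ α₂ a e S : ℂ} {m : ℕ} (hS : S ≠ 0) (he : e ≠ 0)
    (hadd : α₁ + α₂ = a * (S ^ m)⁻¹) (hmul : α₁ * α₂ = e) :
    (X - C ((S ^ m)⁻¹ * α₁)⁻¹) * (X - C ((S ^ m)⁻¹ * α₂)⁻¹) =
      X ^ 2 - C (a * e⁻¹) * X + C (e⁻¹ * (S ^ 2) ^ m) := by
  have hα₁ : α₁ ≠ 0 := by
    rintro rfl
    exact he (by rw [← hmul, zero_mul])
  have hα₂ : α₂ ≠ 0 := by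
    rintro rfl
    exact he (by rw [← hmul, mul_zero])
  have hP : S ^ m ≠ 0 := pow_ne_zero _ hS
  have e1 : ((S ^ m)⁻¹ * α₁)⁻¹ = S ^ m * α₁⁻¹ := by rw [_root_.mul_inv_rev, inv_inv, mul_comm]
  have e2 : ((S ^ m)⁻¹ * α₂)⁻¹ = S ^ m * α₂⁻¹ := by rw [_root_.mul_inv_rev, inv_inv, mul_comm]
  have hsum : S ^ m * α₁⁻¹ + S ^ m * α₂⁻¹ = a * e⁻¹ := by
    rw [← hmul, ← mul_add, inv_add_inv hα₁ hα₂, hadd]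
    field_simp
  have hprod : S ^ m * α₁⁻¹ * (S ^ m * α₂⁻¹) = e⁻¹ * (S ^ 2) ^ m := by
    rw [← hmul, mul_inv, ← pow_mul, mul_comm 2 m, pow_mul]
    ring
  rw [e1, e2]
  calc (X - C (S ^ m * α₁⁻¹)) * (X - C (S ^ m * α₂⁻¹))
      = X ^ 2 - C (S ^ m * α₁⁻¹ + S ^ m * α₂⁻¹) * X + C (S ^ m * α₁⁻¹ * (S ^ m * α₂⁻¹)) := by
        simp only [map_add, map_mul]
        ring
    _ = _ := by rw [hsum, hprod]

/-- `det n(b) = 1`: duplicate of `Literature.NumberTheory.Automorphic.det_upperRightHom`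
(`NewformAdelisationCuspidal.lean`), kept as a deprecated alias. [folklore] -/
@[deprecated Literature.NumberTheory.Automorphic.det_upperRightHom (since := "2026-08-16")]
alias det_upperRightHom_eq_one := Literature.NumberTheory.Automorphic.det_upperRightHom

/-- **`r(h) [Φ] = [Φ]` in `W / W'` from the identity of functions `r(h) Φ = Φ`.** [folklore] -/
theorem finiteRep_mkQ_eq_of {hcpt : isCompact_glFiniteIntegralLevel 2 ℚ}
    (π : AutomorphicRepData (AutomorphyDatum.gl 2 ℚ hcpt)) (h : (AutomorphyDatum.gl 2 ℚ hcpt).finiteAdelic)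
    (Φ : π.W)
    (hR : rightTranslation (AdelicGroupData.gl 2 ℚ)
        ((h : (AutomorphyDatum.gl 2 ℚ hcpt).finiteAdelic) : (AdelicGroupData.gl 2 ℚ).Adelic)
        (Φ : (AdelicGroupData.gl 2 ℚ).Adelic → ℂ) = Φ) :
    π.finiteRep h (π.mkQ Φ) = π.mkQ Φ := by
  rw [Submodule.mkQ_apply, AutomorphicRepData.finiteRep_mk]
  congr 1
  exact Subtype.ext hR

/-- **`∑ⱼ r(g_j) [Φ] = λ [Φ]` in `W / W'` from the identity of functions `∑ⱼ r(g_j) Φ = λ Φ`.**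
[folklore] -/
theorem sum_finiteRep_mkQ_eq_smul {hcpt : isCompact_glFiniteIntegralLevel 2 ℚ}
    (π : AutomorphicRepData (AutomorphyDatum.gl 2 ℚ hcpt)) {n : ℕ}
    (gs : Fin n → (AutomorphyDatum.gl 2 ℚ hcpt).finiteAdelic) (Φ : π.W) (lam : ℂ)
    (h : ∑ j, rightTranslation (AdelicGroupData.gl 2 ℚ)
        ((gs j : (AutomorphyDatum.gl 2 ℚ hcpt).finiteAdelic) : (AdelicGroupData.gl 2 ℚ).Adelic)
        (Φ : (AdelicGroupData.gl 2 ℚ).Adelic → ℂ) = lam • (Φ : (AdelicGroupData.gl 2 ℚ).Adelic → ℂ)) :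
    ∑ j, π.finiteRep (gs j) (π.mkQ Φ) = lam • π.mkQ Φ := by
  have hj : ∀ j, π.finiteRep (gs j) (π.mkQ Φ) =
      π.mkQ ⟨rightTranslation (AdelicGroupData.gl 2 ℚ)
        ((gs j : (AutomorphyDatum.gl 2 ℚ hcpt).finiteAdelic) : (AdelicGroupData.gl 2 ℚ).Adelic) Φ,
        π.stable.finite_stable (gs j) (gs j).2 Φ.2⟩ := fun j => rfl
  simp_rw [hj]
  rw [← map_sum, ← map_smul]
  congr 1
  apply Subtype.ext
  rw [Submodule.coe_sum, Submodule.coe_smul]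
  exact h

/-- **The cuspidal datum `π = π_g ⊗ |det|_𝔸^{(k-1)/2}` of a newform `g ∈ S_k(Γ₁(N))`, `k ≥ 2`, and
its new vector** (Gelbart 1975, §5.C, Thm. 5.19, WITHOUT the finite-order twist of
`Gelbart1975_exists_cuspidalRepData_LAlgebraic_holds`): `π₀` is the datum generated by the adelic
lift `φ_g` (`CuspidalAutomorphicRepData.ofCuspForm`), `π = π₀ ⊗ |det|^{(k-1)/2}`
(`exists_cuspidalAutomorphicRepData_map_mulChar_detTwist`).  Then:
(i) `π` has the infinity type `{(k-1, 0), (0, k-1)}`;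
(ii) at `ℓ ∤ N`, `π` has a Satake parameter `α` with
`∏_{a ∈ α} (X - a⁻¹) = X² - a_ℓ χ(ℓ)⁻¹ X + χ(ℓ)⁻¹ ℓ^{k-1}`;
(iii) the class `q₀` of `φ_g · |det|^{(k-1)/2}` in `W / W'` is non-zero, fixed by `{1} × K₁(N)`,
and for every `w ∣ N` an eigenvector of `U_w = ∑_{j<ℓ} r(ι_w(ℓ j; 0 1))` with eigenvalue
`ℓ^{-(k-1)/2} a_ℓ(g) / (√ℓ)^{k-2}` (`sum_adelicLiftFun_mul_eq_of_isNewform1_of_dvd`).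
[cite: Gelbart1975, Thm. 5.19 and Lemma 5.16, pp. 60–62] [cite: BuzzardGeeLMS2014, §3.1]
[cite: DiamondShurman2005, Prop. 5.2.1] -/
theorem exists_detTwist_datum (g : CuspForm (Gamma1 N) k) (hk : 2 ≤ k) (hg : IsNewform1 g)
    (hcpt : isCompact_glFiniteIntegralLevel 2 ℚ) :
    ∃ π : CuspidalAutomorphicRepData 2 ℚ hcpt,
      π.1.HasInfinityType (fun _ =>
        ({⟨(k : ℂ) - 1, 0, ⟨k - 1, by push_cast; ring⟩⟩, ⟨0, (k : ℂ) - 1, ⟨1 - k, by push_cast; ring⟩⟩} :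
          Multiset ArchWeight)) ∧
      (∀ ℓ : ℕ, ℓ.Prime → ¬ ℓ ∣ N →
        ∀ w : HeightOneSpectrum (𝓞 ℚ), (ℓ : 𝓞 ℚ) ∈ w.asIdeal →
          ∃ α : Multiset ℂ, π.1.HasSatakeParamAt w α ∧
            (α.map fun a => X - C a⁻¹).prod =
              X ^ 2 - C ((qExpansion 1 ⇑g).coeff ℓ * (nebentypus g (ℓ : ZMod N) : ℂ)⁻¹) * X +
                C ((nebentypus g (ℓ : ZMod N) : ℂ)⁻¹ * (ℓ : ℂ) ^ (k - 1))) ∧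
      ∃ q₀ : π.1.Quot, q₀ ≠ 0 ∧
        (∀ u (hu : u ∈ gammaOneFiniteLevel ℚ (Ideal.span {(N : 𝓞 ℚ)})),
          π.1.finiteRep ⟨GLn.ofFinite 2 ℚ u, u, rfl⟩ q₀ = q₀) ∧
        ∀ w : HeightOneSpectrum (𝓞 ℚ), w.asIdeal ∣ Ideal.span {(N : 𝓞 ℚ)} →
          ∑ j : Fin (natGenerator w), π.1.finiteRep ⟨GLn.ofLocal 2 ℚ w
              (heckeLocalRep (Rat.localUniformizer w : w.adicCompletion ℚ)
                (fun i : Fin (natGenerator w) => algebraMap ℚ (w.adicCompletion ℚ) ((i : ℕ) : ℚ))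
                (Rat.localUniformizer w).ne_zero (some j)), GLn.ofLocal_mem_range_ofFinite w _⟩ q₀ =
            (((natGenerator w : ℕ) : ℂ) ^ (-((((k : ℝ) - 1) / 2 : ℝ) : ℂ)) *
              (heckeEigenvalue g (natGenerator w) / (((Real.sqrt (natGenerator w) : ℝ) : ℂ) ^ (k - 2)))) • q₀ := by
  classical
  obtain ⟨m, hm⟩ : ∃ m : ℕ, k - 1 = m := ⟨(k - 1).toNat, (Int.toNat_of_nonneg (by omega)).symm⟩
  -- the cuspidal datum generated by `φ_g` and its infinity type
  set π₀ : CuspidalAutomorphicRepData 2 ℚ hcpt := CuspidalAutomorphicRepData.ofCuspForm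
    (adelicLiftFunA_mem_cuspFormsGL g hcpt) (adelicLiftFunA_ne_zero hg.ne_zero) with hπ₀
  have harch : π₀.1.HasArchParameter fun _ => ({((k : ℂ) - 1) / 2, (1 - (k : ℂ)) / 2} : Multiset ℂ) :=
    hasArchParameter_ofCuspForm_adelicLiftFunA g hg.ne_zero
  set w₁ : ArchWeight := ⟨((k : ℂ) - 1) / 2, (1 - (k : ℂ)) / 2, ⟨k - 1, by push_cast; ring⟩⟩ with hw₁
  set w₂ : ArchWeight := ⟨(1 - (k : ℂ)) / 2, ((k : ℂ) - 1) / 2, ⟨1 - k, by push_cast; ring⟩⟩ with hw₂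
  set T₀ : InfinityType ℚ 2 := fun _ => ({w₁, w₂} : Multiset ArchWeight) with hT₀
  have hsw₁ : w₁.swap = w₂ := rfl
  have hsw₂ : w₂.swap = w₁ := rfl
  have hT₀wf : T₀.IsWellFormed := by
    refine ⟨fun σ => by simp [hT₀], fun σ => ?_⟩
    show ({w₁, w₂} : Multiset ArchWeight) = Multiset.map ArchWeight.swap {w₁, w₂}
    rw [Multiset.insert_eq_cons, Multiset.map_cons, Multiset.map_singleton, hsw₁, hsw₂]
    exact Multiset.cons_swap w₁ w₂ 0
  have hT₀a : (fun σ => (T₀ σ).map ArchWeight.a) =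
      fun _ => ({((k : ℂ) - 1) / 2, (1 - (k : ℂ)) / 2} : Multiset ℂ) := by
    funext σ
    rfl
  have hIT₀ : π₀.1.HasInfinityType T₀ := by
    refine ⟨hT₀wf, ?_⟩
    rw [hT₀a]
    exact harch
  -- the twist by `|det|_𝔸^{(k-1)/2}`
  obtain ⟨χn, hχn⟩ := exists_heckeCharacter_ideleNorm_cpow ℚ ((((k : ℝ) - 1) / 2 : ℝ) : ℂ)
  obtain ⟨π₁, hW, hW'⟩ := exists_cuspidalAutomorphicRepData_map_mulChar_detTwist hχn π₀
  have hIT₁ : π₁.1.HasInfinityType (T₀.twist ((((k : ℝ) - 1) / 2 : ℝ) : ℂ)) :=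
    AutomorphicRepData.HasInfinityType.of_map_mulChar_detTwist hχn hW hW' hIT₀
  have hTeq : T₀.twist ((((k : ℝ) - 1) / 2 : ℝ) : ℂ) = fun _ =>
      ({⟨(k : ℂ) - 1, 0, ⟨k - 1, by push_cast; ring⟩⟩, ⟨0, (k : ℂ) - 1, ⟨1 - k, by push_cast; ring⟩⟩} :
        Multiset ArchWeight) := by
    funext σ
    rw [InfinityType.twist_apply, hT₀]
    simp only [Multiset.insert_eq_cons, Multiset.map_cons, Multiset.map_singleton]
    congr 1
    · ext
      · simp only [hw₁, ArchWeight.twist_a]; push_cast; ring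
      · simp only [hw₁, ArchWeight.twist_b]; push_cast; ring
    · congr 1
      ext
      · simp only [hw₂, ArchWeight.twist_a]; push_cast; ring
      · simp only [hw₂, ArchWeight.twist_b]; push_cast; ring
  refine ⟨π₁, hTeq ▸ hIT₁, ?_, ?_⟩
  · -- the Satake parameters at `ℓ ∤ N`
    intro ℓ hℓ hℓN w hw
    have hgen : natGenerator w = ℓ :=
      (Nat.prime_dvd_prime_iff_eq (prime_natGenerator w) hℓ).mp
        ((GaloisRepresentations.Rat.natCast_mem_asIdeal_iff w).mp hw)
    subst hgen
    obtain ⟨α₁, α₂, hadd, hmul, h0⟩ :=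
      exists_hasSatakeParamAt_ofCuspForm_adelicLiftFunA (hcpt := hcpt) hg hℓN
    have h1 := AutomorphicRepData.HasSatakeParamAt.of_map_mulChar_detTwist_of_cpow hχn hW hW' h0
    refine ⟨_, h1, ?_⟩
    rw [GaloisRepresentations.Rat.residueCard_eq_natGenerator]
    simp only [Multiset.insert_eq_cons, Multiset.map_cons, Multiset.map_singleton, Multiset.prod_cons,
      Multiset.prod_singleton]
    have hS : ((Real.sqrt (natGenerator w) : ℝ) : ℂ) ≠ 0 := by
      exact_mod_cast (Real.sqrt_pos.2 (Nat.cast_pos.2 (prime_natGenerator w).pos)).ne'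
    have hS2 : ((Real.sqrt (natGenerator w) : ℝ) : ℂ) ^ 2 = ((natGenerator w : ℕ) : ℂ) := by
      rw [← Complex.ofReal_pow, Real.sq_sqrt (Nat.cast_nonneg _), Complex.ofReal_natCast]
    have hu : IsUnit ((natGenerator w : ℕ) : ZMod N) :=
      ZMod.isUnit_prime_of_not_dvd (prime_natGenerator w) hℓN
    have he : nebentypus g ((natGenerator w : ℕ) : ZMod N) ≠ 0 := (hu.map (nebentypus g)).ne_zero
    rw [natCast_cpow_neg_half_weight' hm,
      show ((natGenerator w : ℕ) : ℂ) ^ (k - 1) = (((Real.sqrt (natGenerator w) : ℝ) : ℂ) ^ 2) ^ m by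
        rw [hm, zpow_natCast, hS2]]
    rw [show (1 : ℤ) - k = -(m : ℤ) by omega, _root_.zpow_neg, zpow_natCast] at hadd
    exact prod_X_sub_C_inv_pair_detTwist hS he hadd hmul
  · -- the new vector `q₀ = [φ_g · |det|^{(k-1)/2}]`
    set c : (AdelicGroupData.gl 2 ℚ).Adelic →* ℂˣ := detTwist 2 χn with hc
    set Φ : (AdelicGroupData.gl 2 ℚ).Adelic → ℂ := mulChar c (adelicLiftFunA N k g) with hΦ
    have hΦW : Φ ∈ π₁.1.W := by
      rw [hW]
      exact Submodule.mem_map_of_mem (CuspidalAutomorphicRepData.mem_W_ofCuspForm _ _)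
    -- `|det u|^{(k-1)/2} = 1` on `{1} × K₁(N)`
    have hc1 : ∀ u ∈ gammaOneFiniteLevel ℚ (Ideal.span {(N : 𝓞 ℚ)}), c (GLn.ofFinite 2 ℚ u) = 1 := by
      intro u hu
      have hmem : GLn.ofFinite 2 ℚ u ∈ glIntegralLevel 2 ℚ := by
        rw [mem_glIntegralLevel_iff, GLn.sndHom_ofFinite, GLn.fstHom_ofFinite]
        exact ⟨gammaZeroFiniteLevel_le_glFiniteIntegralLevel _ (gammaOneFiniteLevel_le_gammaZeroFiniteLevel _ hu), rfl⟩
      rw [hc, detTwist_apply']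
      exact apply_det_eq_one_of_mem_finiteLevelsGL hχn (glIntegralLevel_mem_finiteLevelsGL 2 ℚ hcpt) hmem
    -- `φ_g` is right `{1} × K₁(N)`-invariant
    have hRφ : ∀ u ∈ gammaOneFiniteLevel ℚ (Ideal.span {(N : 𝓞 ℚ)}),
        rightTranslation (AdelicGroupData.gl 2 ℚ) (GLn.ofFinite 2 ℚ u) (adelicLiftFunA N k g) = adelicLiftFunA N k g := by
      intro u hu
      funext x
      rw [rightTranslation_apply, adelicLiftFunA_apply, adelicLiftFunA_apply]
      exact adelicLiftFun_mul_of_archGL_eq_one g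
        (by rw [Rat.archGL, MonoidHom.comp_apply, GLn.fstHom_ofFinite, map_one]) (by rwa [GLn.sndHom_ofFinite]) x
    refine ⟨π₁.1.mkQ ⟨Φ, hΦW⟩, ?_, ?_, ?_⟩
    · -- `q₀ ≠ 0`: `φ_g · c ∉ W' · c` as `φ_g ∉ W₀'`
      intro h0
      have h0' : (⟨Φ, hΦW⟩ : π₁.1.W) ∈ π₁.1.kerQuot := (Submodule.Quotient.mk_eq_zero π₁.1.kerQuot).1 h0
      rw [AutomorphicRepData.kerQuot, Submodule.mem_comap, Submodule.subtype_apply] at h0'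
      change Φ ∈ π₁.1.W' at h0'
      rw [hW', hΦ] at h0'
      obtain ⟨x, hx, hxe⟩ := h0'
      have hxφ : x = adelicLiftFunA N k g := mulChar_injective c hxe
      exact CuspidalAutomorphicRepData.not_mem_W'_ofCuspForm _ _ (hxφ ▸ hx)
    · -- `K₁(N)`-invariance
      intro u hu
      have hRΦ : rightTranslation (AdelicGroupData.gl 2 ℚ) (GLn.ofFinite 2 ℚ u) Φ = Φ := by
        rw [hΦ, rightTranslation_mulChar, hc1 u hu, Units.val_one, one_smul, hRφ u hu]
      exact finiteRep_mkQ_eq_of π₁.1 _ ⟨Φ, hΦW⟩ hRΦ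
    · -- the `U_w` identity at `w ∣ N`
      intro w hwN
      -- `c(ι_w (ϖ j; 0 1)) = |ϖ|^{(k-1)/2} = ℓ^{-(k-1)/2}`
      have hcy : ∀ j : Fin (natGenerator w), ((c (GLn.ofLocal 2 ℚ w
          (heckeLocalRep (Rat.localUniformizer w : w.adicCompletion ℚ)
            (fun i : Fin (natGenerator w) => algebraMap ℚ (w.adicCompletion ℚ) ((i : ℕ) : ℚ))
            (Rat.localUniformizer w).ne_zero (some j))) : ℂˣ) : ℂ) =
          ((natGenerator w : ℕ) : ℂ) ^ (-((((k : ℝ) - 1) / 2 : ℝ) : ℂ)) := by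
        intro j
        have hcmul : ∀ x y : GL (Fin 2) (AdeleRing (𝓞 ℚ) ℚ), c (x * y) = c x * c y := fun x y => map_mul c x y
        rw [heckeLocalRep_some_eq, map_mul, hcmul, Units.val_mul, ← heckeDiagAt_two_one_eq_ofLocal, hc,
          detTwist_heckeDiagAt_of_cpow hχn (Rat.valued_localUniformizer w) (by norm_num : 1 ≤ 2), pow_one,
          GaloisRepresentations.Rat.residueCard_eq_natGenerator, detTwist_apply', GLn.det_ofLocal,
          Automorphic.det_upperRightHom, map_one, map_one, Units.val_one, one_mul]
      -- `∑ⱼ r(ι_w y_j) (φ_g · c) = (ℓ^{-(k-1)/2} λ₀) · (φ_g · c)` as functions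
      have hUφ : ∑ j : Fin (natGenerator w), rightTranslation (AdelicGroupData.gl 2 ℚ) (GLn.ofLocal 2 ℚ w
          (heckeLocalRep (Rat.localUniformizer w : w.adicCompletion ℚ)
            (fun i : Fin (natGenerator w) => algebraMap ℚ (w.adicCompletion ℚ) ((i : ℕ) : ℚ))
            (Rat.localUniformizer w).ne_zero (some j))) (adelicLiftFunA N k g) =
          (heckeEigenvalue g (natGenerator w) / (((Real.sqrt (natGenerator w) : ℝ) : ℂ) ^ (k - 2))) •
            adelicLiftFunA N k g := by
        funext x
        rw [Finset.sum_apply, Pi.smul_apply, smul_eq_mul]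
        simp only [rightTranslation_apply, adelicLiftFunA_apply]
        exact sum_adelicLiftFun_mul_eq_of_isNewform1_of_dvd hg hwN x
      have hUΦ : ∑ j : Fin (natGenerator w), rightTranslation (AdelicGroupData.gl 2 ℚ) (GLn.ofLocal 2 ℚ w
          (heckeLocalRep (Rat.localUniformizer w : w.adicCompletion ℚ)
            (fun i : Fin (natGenerator w) => algebraMap ℚ (w.adicCompletion ℚ) ((i : ℕ) : ℚ))
            (Rat.localUniformizer w).ne_zero (some j))) Φ =
          (((natGenerator w : ℕ) : ℂ) ^ (-((((k : ℝ) - 1) / 2 : ℝ) : ℂ)) *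
            (heckeEigenvalue g (natGenerator w) / (((Real.sqrt (natGenerator w) : ℝ) : ℂ) ^ (k - 2)))) • Φ := by
        simp_rw [hΦ, rightTranslation_mulChar, hcy]
        rw [← Finset.smul_sum, ← map_sum, hUφ, map_smul, smul_smul]
      exact sum_finiteRep_mkQ_eq_smul π₁.1 (fun j => ⟨GLn.ofLocal 2 ℚ w
          (heckeLocalRep (Rat.localUniformizer w : w.adicCompletion ℚ)
            (fun i : Fin (natGenerator w) => algebraMap ℚ (w.adicCompletion ℚ) ((i : ℕ) : ℚ))
            (Rat.localUniformizer w).ne_zero (some j)), GLn.ofLocal_mem_range_ofFinite w _⟩) ⟨Φ, hΦW⟩ _ hUΦ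

end Datum

/-! ### D-d. Assembly: Hida's Theorem 3.26 (2) at `ℓ ∣ N` from the Carayol carrier alone -/

section Assembly

open scoped Valued
open ValuativeRel

variable {N : ℕ}

/-- `FramedRep.scalar` is Mathlib's `GeneralLinearGroup.scalar`. [folklore] -/
theorem framedRep_scalar_eq {A : Type*} [CommRing A] [TopologicalSpace A] {n : ℕ} (a : Aˣ) :
    FramedRep.scalar A n a = Matrix.GeneralLinearGroup.scalar (Fin n) a := by
  refine Units.ext ?_
  rw [FramedRep.coe_scalar_apply, Matrix.GeneralLinearGroup.coe_scalar, Matrix.algebraMap_eq_diagonal,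
    Matrix.scalar_apply]
  rfl

/-- **Hida (2000), Thm. 3.26 (2) for `ℓ ∣ N` — the named fact
`Hida2000_thm326_inertia_of_level` — from the tree's Carayol carrier
`Automorphic.galoisRep_GL2_totallyReal_localGlobal` ALONE.**  For a newform `g ∈ S_k(Γ₁(N))`,
`k ≥ 2`, `ρ : Γ_ℚ → GL₂(ℚ̄_p)` irreducible and attached to `g` away from `Np`, `ℓ ∣ N`, `ℓ ≠ p`,
`v_ℓ(N) = v_ℓ(cond χ)`: `ρ|_{I_ℓ} ≃ χ ⊕ 1`.  Proof (Hida, pp. 152–153, via Carayol 1986, Thm. (A)):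
apply the carrier to the pair `(π, r) = (π_g ⊗ |det|^{(k-1)/2}, ρ ⊗ (ι⁻¹ ∘ χ ∘ χ_N)⁻¹)`
(`exists_detTwist_datum`; the twist matches `r(Frob_ℓ')` with the inverse-root Satake
polynomial `X² - a_{ℓ'} χ(ℓ')⁻¹ X + χ(ℓ')⁻¹ ℓ'^{k-1}` of `π` at every `ℓ' ∤ Np`);
at `w ∣ ℓ` the carrier gives the local component `π_w`, the Weil–Deligne representation `r_w`
of `r|_{Γ_{ℚ_w}}`, `ι(r_w)` and `ι(r_w)^{F-ss} ∈ rec(π_w)`; the new vector of `π` is a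
`K₁(N)`-fixed `U_w`-eigenvector with eigenvalue `ℓ^{-(k-1)/2} a_ℓ/(√ℓ)^{k-2} ≠ 0`
(`a_ℓ ≠ 0` as `e = e'`, `coeff_ne_zero_of_padicValNat_eq`), so `Z(s, W, 1)` has a pole for
some `W ∈ 𝒲(π_w, ψ_w)` (`exists_rsZeta_not_laurent_of_newvector`), hence `rec(π_w)^{I} ≠ 0`
(`inertiaInvariants_ne_bot_of_rsZeta_not_laurent`) and `tr = 1 + det` on inertia for
`ι(r_w)^{F-ss}`, `ι(r_w)`, `r_w` and `r|_{Γ_{ℚ_w}}` (Part H's transport); untwisting,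
`tr ρ(s) = 1 + ι⁻¹χ(χ_N(s))` on the inertia at `w` (`det ρ = ι⁻¹χ(χ_N) χ_p^{k-1}`,
`det_eq_of_isGaloisRepOfNewform1`, `χ_p = 1` on `I_ℓ`), and Part E's socket
`inertia_shape_of_local_inertial_trace` concludes.
[cite: Hida2000, Thm. 3.26 (2)–(3)(a), pp. 152–153] [cite: CarayolASENS1986, Thm. (A)] -/
theorem inertia_of_level_of_localGlobal' (hX : galoisRep_GL2_totallyReal_localGlobal) :
    Hida2000_thm326_inertia_of_level := by
  intro N _ k g hk hg p _ ι ρ hρ hirr ℓ hℓ hℓp hℓN hcond w hw 𝔔 h𝔔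
  classical
  haveI : NeZero (N : ℚ) := NeZero.charZero
  have hp : (p : ℕ).Prime := Fact.out
  have hcpt : isCompact_glFiniteIntegralLevel 2 ℚ := isCompact_glFiniteIntegralLevel_holds 2 ℚ
  obtain ⟨m, hm⟩ : ∃ m : ℕ, ((m : ℕ) : ℤ) = k - 1 := ⟨(k - 1).toNat, Int.toNat_of_nonneg (by omega)⟩
  have hwℓ : natGenerator w = ℓ :=
    (Nat.prime_dvd_prime_iff_eq (prime_natGenerator w) hℓ).mp ((Rat.natCast_mem_asIdeal_iff w).mp hw)
  have hwN : w.asIdeal ∣ Ideal.span {(N : 𝓞 ℚ)} := (Rat.natGenerator_dvd_iff w N).1 (hwℓ ▸ hℓN)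
  have hpw : ((p : ℕ) : 𝓞 ℚ) ∉ w.asIdeal := by
    rw [Rat.natCast_mem_asIdeal_iff, hwℓ]
    exact fun h => hℓp ((Nat.prime_dvd_prime_iff_eq hℓ hp).mp h)
  -- D-a: the datum and its new vector at `w`
  obtain ⟨π, hT, hSat, q₀, hq₀, hK, hU⟩ := exists_detTwist_datum g hk hg hcpt
  have hUw := hU w hwN
  have hlam : ((natGenerator w : ℕ) : ℂ) ^ (-((((k : ℝ) - 1) / 2 : ℝ) : ℂ)) *
      (heckeEigenvalue g (natGenerator w) / (((Real.sqrt (natGenerator w) : ℝ) : ℂ) ^ (k - 2))) ≠ 0 := by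
    haveI : Fact ℓ.Prime := ⟨hℓ⟩
    rw [hwℓ]
    refine mul_ne_zero ?_ (div_ne_zero ?_ ?_)
    · rw [Ne, Complex.cpow_eq_zero_iff, not_and_or]
      exact Or.inl (by exact_mod_cast hℓ.ne_zero)
    · rw [IsNewform1.heckeEigenvalue_eq_coeff_holds hg hℓ]
      exact coeff_ne_zero_of_padicValNat_eq hg hℓ hℓN hcond
    · exact zpow_ne_zero _ (by exact_mod_cast (Real.sqrt_pos.2 (Nat.cast_pos.2 hℓ.pos)).ne')
  have hLR := isLAlgebraic_of_hasInfinityType_weight (π := π) (by omega) hT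
  -- D-b: the Galois twist `r = ρ ⊗ θ`, `θ = (ι⁻¹ ∘ χ ∘ χ_N)⁻¹`
  obtain ⟨θ₀, hθ₀⟩ := exists_continuousMonoidHom_dirichlet ι (nebentypus g)
  obtain ⟨θ, hθ⟩ : ∃ θ : absoluteGaloisGroup ℚ →ₜ* (PadicAlgCl p)ˣ, ∀ σ, θ σ = (θ₀ σ)⁻¹ :=
    ⟨θ₀⁻¹, fun σ => rfl⟩
  have hθ₀ne : ∀ σ, ((θ₀ σ : (PadicAlgCl p)ˣ) : PadicAlgCl p) ≠ 0 := fun σ => (θ₀ σ).ne_zero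
  obtain ⟨r, hr_def⟩ : ∃ r : FramedGaloisRep ℚ (PadicAlgCl p) 2, r = FramedRep.twist ρ θ := ⟨_, rfl⟩
  have hr : ∀ σ, r σ = Matrix.GeneralLinearGroup.scalar (Fin 2) (θ σ) * ρ σ := fun σ => by
    rw [hr_def, FramedRep.twist_apply, framedRep_scalar_eq]
  have hirr' : r.toGaloisRep.IsIrreducible := FramedRep.isIrreducible_of_twist hr hirr
  -- Satake–Frobenius compatibility of `(π, r)` away from `Np`
  have hAE : SatakeFrobCompatibleAE ι π.1 r := by
    have hS : {v : HeightOneSpectrum (𝓞 ℚ) | ((primesEquiv v : Nat.Primes) : ℕ) ∣ N * p}.Finite := by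
      have hfin : {n : ℕ | n ∣ N * p}.Finite :=
        (N * p).divisors.finite_toSet.subset fun n hn ↦
          Nat.mem_divisors.mpr ⟨hn, mul_ne_zero (NeZero.ne N) hp.ne_zero⟩
      exact (hfin.preimage (f := fun v : HeightOneSpectrum (𝓞 ℚ) ↦ ((primesEquiv v : Nat.Primes) : ℕ))
        fun v _ v' _ h ↦ primesEquiv.injective (Subtype.ext h)).subset fun v hv => hv
    refine Filter.eventually_cofinite.mpr (hS.subset fun v hv => ?_)
    by_contra hvS
    apply hv
    have hq : ((primesEquiv v : Nat.Primes) : ℕ).Prime := (primesEquiv v).2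
    have hqNp : ¬ ((primesEquiv v : Nat.Primes) : ℕ) ∣ N * p := hvS
    have hqN : ¬ ((primesEquiv v : Nat.Primes) : ℕ) ∣ N := fun h ↦ hqNp (h.mul_right p)
    obtain ⟨q, hqdef⟩ : ∃ q : ℕ, ((primesEquiv v : Nat.Primes) : ℕ) = q := ⟨_, rfl⟩
    have hqv : (q : 𝓞 ℚ) ∈ v.asIdeal := by
      rw [Rat.natCast_mem_asIdeal_iff, ← hqdef]
      exact dvd_rfl
    have hqgen : natGenerator v = q :=
      (Nat.prime_dvd_prime_iff_eq (prime_natGenerator v) (hqdef ▸ hq)).mp ((Rat.natCast_mem_asIdeal_iff v).mp hqv)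
    obtain ⟨α, hα, hpoly⟩ := hSat q (hqdef ▸ hq) (hqdef ▸ hqN) v hqv
    obtain ⟨hunr, hfrob⟩ := hρ v hqNp
    have hqres : v.residueCard = q := by rw [GaloisRepresentations.Rat.residueCard_eq_natGenerator, hqgen]
    -- `χ_N(Frob_v) = q`, so `θ(Frob_v) = (ι⁻¹ χ(q))⁻¹`; `θ = 1` on the inertia above `v ∤ N`
    have hNv : ∀ 𝔓 ∈ v.primesAbove, ((N : ℕ) : absIntegers (𝓞 ℚ) ℚ) ∉ 𝔓 := fun 𝔓 h𝔓 =>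
      Rat.natCast_not_mem_of_mem_primesAbove_of_not_dvd h𝔓 hqN
    have hθI : ∀ 𝔓 ∈ v.primesAbove, ∀ σ ∈ 𝔓.inertia (absoluteGaloisGroup ℚ), θ σ = 1 := by
      intro 𝔓 h𝔓 σ hσ
      haveI : 𝔓.IsPrime := h𝔓.1
      rw [hθ, inv_eq_one]
      refine Units.ext ?_
      rw [hθ₀, modNCyclotomicCharacter_eq_one_of_mem_inertia (hNv 𝔓 h𝔓) hσ, Units.val_one, Units.val_one,
        MulChar.map_one, map_one]
    obtain ⟨cq, hcq⟩ : ∃ cq : PadicAlgCl p, cq = (ι.symm (nebentypus g (q : ZMod N)))⁻¹ := ⟨_, rfl⟩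
    have hθF : ∀ 𝔓 ∈ v.primesAbove, ∀ σ : absoluteGaloisGroup ℚ, IsArithFrobAt (𝓞 ℚ) σ 𝔓 →
        ((θ σ : (PadicAlgCl p)ˣ) : PadicAlgCl p) = cq := by
      intro 𝔓 h𝔓 σ hσ
      rw [hθ, Units.val_inv_eq_inv_val, hθ₀, modNCyclotomicCharacter_eq_residueCard_of_isArithFrobAt h𝔓 (hNv 𝔓 h𝔓) hσ,
        hqres, hcq]
    refine ⟨α, hα, hr_def ▸ FramedGaloisRep.isUnramifiedAt_twist hunr hθI, ?_⟩
    -- the two Frobenius polynomials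
    intro 𝔓 h𝔓 σ hσ
    obtain ⟨M, hMdef⟩ : ∃ M : Matrix (Fin 2) (Fin 2) (PadicAlgCl p),
        M = ((ρ σ : GL (Fin 2) (PadicAlgCl p)) : Matrix (Fin 2) (Fin 2) (PadicAlgCl p)) := ⟨_, rfl⟩
    have hM : M.charpoly = (heckePolynomial g q).map
        ((ι.symm : ℂ →+* PadicAlgCl p).comp (algebraMap (coeffCharField g) ℂ)) := by
      rw [hMdef, ← hqdef]
      exact hfrob 𝔓 h𝔓 σ hσ
    have hM' : M.charpoly = X ^ 2 - C (ι.symm ((qExpansion 1 ⇑g).coeff q)) * X +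
        C (ι.symm ((nebentypus g (q : ZMod N) : ℂ) * (q : ℂ) ^ (k - 1))) := by
      rw [hM, ← Polynomial.map_map, map_heckePolynomial]
      simp only [Polynomial.map_add, Polynomial.map_sub, Polynomial.map_mul, Polynomial.map_pow, Polynomial.map_X,
        Polynomial.map_C, RingHom.coe_coe]
    have htrM : M.trace = ι.symm ((qExpansion 1 ⇑g).coeff q) := by
      have h := congrArg (fun P : (PadicAlgCl p)[X] => P.coeff 1) hM'
      simp only [Matrix.charpoly_fin_two, coeff_add, coeff_sub, coeff_X_pow, coeff_C_mul, coeff_X_one, coeff_C,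
        if_neg (show (1 : ℕ) ≠ 2 by norm_num), if_neg (show (1 : ℕ) ≠ 0 by norm_num)] at h
      simpa using h
    have hdetM : M.det = ι.symm ((nebentypus g (q : ZMod N) : ℂ) * (q : ℂ) ^ (k - 1)) := by
      have h := congrArg (fun P : (PadicAlgCl p)[X] => P.coeff 0) hM'
      simp only [Matrix.charpoly_fin_two, coeff_add, coeff_sub, coeff_X_pow, coeff_C_mul, coeff_X_zero, coeff_C_zero,
        if_neg (show (0 : ℕ) ≠ 2 by norm_num), mul_zero, sub_zero, zero_add] at h
      exact h
    have hχq : nebentypus g (q : ZMod N) ≠ 0 :=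
      ((ZMod.isUnit_prime_of_not_dvd (hqdef ▸ hq) (hqdef ▸ hqN)).map (nebentypus g)).ne_zero
    have hιχ : ι.symm (nebentypus g (q : ZMod N)) ≠ 0 := by
      rwa [Ne, map_eq_zero_iff _ ι.symm.injective]
    have hA : cq * ι.symm ((qExpansion 1 ⇑g).coeff q) =
        ι.symm ((qExpansion 1 ⇑g).coeff q * (nebentypus g (q : ZMod N) : ℂ)⁻¹) := by
      rw [map_mul, map_inv₀, hcq]
      ring
    have hB : cq ^ 2 * ι.symm ((nebentypus g (q : ZMod N) : ℂ) * (q : ℂ) ^ (k - 1)) =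
        ι.symm ((nebentypus g (q : ZMod N) : ℂ)⁻¹ * (q : ℂ) ^ (k - 1)) := by
      rw [map_mul, map_mul, map_inv₀, hcq]
      field_simp
    -- `∏ (X - ι⁻¹(a⁻¹))` is the `ι⁻¹`-image of the complex polynomial of `hpoly`
    have hmapC : (α.map fun a => X - C (ι.symm a⁻¹)).prod =
        ((α.map fun a => X - C a⁻¹).prod).map (ι.symm : ℂ →+* PadicAlgCl p) := by
      rw [Polynomial.map_multiset_prod, Multiset.map_map]
      refine congrArg _ (Multiset.map_congr rfl fun a _ => ?_)
      simp only [Function.comp_apply, Polynomial.map_sub, Polynomial.map_X, Polynomial.map_C, RingHom.coe_coe]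
    change Matrix.charpoly ((r σ : GL (Fin 2) (PadicAlgCl p)) : Matrix (Fin 2) (Fin 2) (PadicAlgCl p)) = _
    rw [hr_def, FramedRep.coe_twist_apply, hθF 𝔓 h𝔓 σ hσ, ← hMdef, Matrix.charpoly_fin_two, Matrix.trace_smul,
      Matrix.det_smul, Fintype.card_fin, smul_eq_mul, htrM, hdetM, hA, hB, hqres, arithFrobPolyOfSatake_one, hmapC,
      hpoly]
    simp only [Polynomial.map_add, Polynomial.map_sub, Polynomial.map_mul, Polynomial.map_pow, Polynomial.map_X,
      Polynomial.map_C, RingHom.coe_coe]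
  -- the carrier at `(ℚ, π, p, ι, r)`
  obtain ⟨llc, hllc⟩ := hX ℚ inferInstance
  obtain ⟨-, hloc⟩ := hllc hcpt π hLR.1 hLR.2 p ι r hirr' hAE
  obtain ⟨πv, rv, rC, hπv, hlad, -, hTr, hcls⟩ := hloc w
  have hWD : IsWeilDeligneOfLadic (r.toLocal w).toWeilGroupHom rv := hlad hpw
  -- D-c: the zeta witness of FILE C for `π_w` forces `tr = 1 + det` on inertia for `ι(r_w)`
  letI : MeasurableSpace
      (GL (Fin 1) (w.adicCompletion ℚ) ⧸ upperUnitriangular (Fin 1) (w.adicCompletion ℚ)) := borel _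
  haveI : BorelSpace
      (GL (Fin 1) (w.adicCompletion ℚ) ⧸ upperUnitriangular (Fin 1) (w.adicCompletion ℚ)) := ⟨rfl⟩
  obtain ⟨ψ, ν, hψ, hgen, hinv, hfin, hpos, Λ, hΛ, Λ', hΛ', v, v', hno⟩ :=
    exists_rsZeta_not_laurent_of_newvector π q₀ hq₀ hK hlam hUw πv hπv
  haveI := hinv
  haveI := hfin
  haveI := hpos
  obtain ⟨r', hr', hq⟩ := hcls
  have hInv : r'.inertiaInvariants ≠ ⊥ :=
    inertiaInvariants_ne_bot_of_rsZeta_not_laurent (llc w) πv hψ hgen hΛ hΛ' v v' hno r' hr'.isFrobSemisimple hq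
  have htr : ∀ u ∈ WeilGroup.inertia (w.adicCompletion ℚ),
      LinearMap.trace ℂ _ (rC.ρ u) = 1 + LinearMap.det (rC.ρ u) := by
    intro u hu
    rw [← hr'.2.1 u hu]
    exact trace_eq_one_add_det_of_inertiaInvariants_ne_bot r' hInv u hu
  -- D-d: transport to `r|_{Γ_{ℚ_w}}` on the inertia group, untwist, and apply Part E's socket
  refine inertia_shape_of_local_inertial_trace g hk p ι ρ hρ hℓ hℓp hℓN hcond hw ?_ 𝔔 h𝔔
  intro s hs
  obtain ⟨𝔓₀, h𝔓₀, -, hres⟩ := exists_primesAbove_forall_inertia_absGaloisRestrict ℚ w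
  -- `tr r(s) = 1 + det r(s)` for `s` in the local inertia
  have hs' : s ∈ (WeilGroup.inertia (w.adicCompletion ℚ)).map (WeilGroup.toAbsGalois _) := by
    rw [WeilGroup.inertia_map_toAbsGalois]
    exact hs
  obtain ⟨u, hu, rfl⟩ := Subgroup.mem_map.mp hs'
  have h1 := hWD.trace_eq_of_mem_inertia u hu
  have h2 := hWD.det_eq_of_mem_inertia u hu
  rw [FramedRep.toWeilGroupHom_apply] at h1 h2
  rw [FramedGaloisRep.toLocal_apply] at h1 h2 ⊢
  have hrtd : ((r (absGaloisRestrict ℚ (w.adicCompletion ℚ) (WeilGroup.toAbsGalois _ u)) : GL (Fin 2) (PadicAlgCl p)) :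
        Matrix (Fin 2) (Fin 2) (PadicAlgCl p)).trace =
      1 + ((r (absGaloisRestrict ℚ (w.adicCompletion ℚ) (WeilGroup.toAbsGalois _ u)) : GL (Fin 2) (PadicAlgCl p)) :
        Matrix (Fin 2) (Fin 2) (PadicAlgCl p)).det := by
    rw [h1, h2, ← linearMap_trace_eq_trace_toMatrix', LinearMap.det_toMatrix']
    apply ι.injective
    have ht := trace_eq_of_isTransportAlong hTr u
    have hd := det_eq_of_isTransportAlong hTr u
    have h := htr u hu
    rw [ht, hd] at h
    rw [map_add, map_one]
    exact h
  -- untwist: `r(σ) = θ(σ) • ρ(σ)`, `det ρ(σ) = θ₀(σ) χ_p(σ)^m = θ₀(σ)` on inertia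
  have hσI : absGaloisRestrict ℚ (w.adicCompletion ℚ) (WeilGroup.toAbsGalois _ u) ∈
      𝔓₀.inertia (absoluteGaloisGroup ℚ) := hres _ hs
  have hdetρ : ((ρ (absGaloisRestrict ℚ (w.adicCompletion ℚ) (WeilGroup.toAbsGalois _ u)) :
        GL (Fin 2) (PadicAlgCl p)) : Matrix (Fin 2) (Fin 2) (PadicAlgCl p)).det =
      ((θ₀ (absGaloisRestrict ℚ (w.adicCompletion ℚ) (WeilGroup.toAbsGalois _ u)) : (PadicAlgCl p)ˣ) :
        PadicAlgCl p) := by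
    rw [det_eq_of_isGaloisRepOfNewform1 (continuous_algebraMap ℚ_[p] (PadicAlgCl p)) hρ hm,
      cyclotomicCharacter_eq_one_of_mem_inertia hpw h𝔓₀ hσI, Units.val_one, PadicInt.coe_one, map_one, one_pow,
      mul_one, RingHom.comp_apply, hθ₀]
    rfl
  rw [hr_def, FramedRep.coe_twist_apply, Matrix.trace_smul, Matrix.det_smul, Fintype.card_fin, hdetρ, smul_eq_mul,
    hθ, Units.val_inv_eq_inv_val] at hrtd
  -- `θ₀⁻¹ tr ρ = 1 + θ₀⁻² θ₀`, i.e. `tr ρ = θ₀ + 1 = 1 + ι⁻¹χ(χ_N σ)`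
  obtain ⟨X0, hX0⟩ : ∃ X0 : PadicAlgCl p,
      ((θ₀ (absGaloisRestrict ℚ (w.adicCompletion ℚ) (WeilGroup.toAbsGalois _ u)) : (PadicAlgCl p)ˣ) :
        PadicAlgCl p) = X0 := ⟨_, rfl⟩
  obtain ⟨T0, hT0⟩ : ∃ T0 : PadicAlgCl p,
      ((ρ (absGaloisRestrict ℚ (w.adicCompletion ℚ) (WeilGroup.toAbsGalois _ u)) :
        GL (Fin 2) (PadicAlgCl p)) : Matrix (Fin 2) (Fin 2) (PadicAlgCl p)).trace = T0 := ⟨_, rfl⟩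
  have hx : X0 ≠ 0 := hX0 ▸ hθ₀ne _
  rw [hX0, hT0] at hrtd
  have key : T0 = 1 + X0 := by
    have h2 : X0 * (X0⁻¹ * T0) = X0 * (1 + X0⁻¹ ^ 2 * X0) := by rw [hrtd]
    rw [← mul_assoc, mul_inv_cancel₀ hx, one_mul] at h2
    rw [h2]
    field_simp
    ring
  rw [hT0, key, ← hX0, hθ₀]

end Assembly

end Literature.NumberTheory.EllipticCurves.Hida2000Thm326

end
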